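import Summits.Ventures.WeilGRH.KeySectionPrinciple
import Mathlib.Analysis.Calculus.BumpFunction.Convolution
import Mathlib.Analysis.Calculus.ContDiff.Convolution
import HarnessLib

/-!
# GRH arm (rh-explicit, venture WeilGRH): smoothing a window function — mollified sections are test
  functions, converge in the shift pairings, and DECREASE every increment (Jensen contraction)

Cell `rh-explicit`, WEIL TRACK — GRH ARM (lit/typing seat weil-grh-5; the analytic half of the bridge from SECTION
language back to TEST-FUNCTION language, GRH-LIT-AS-PRINTED A27 reading (b): «margin over `C_c^∞` ⇒ statement about
a trigonometric section» needs the converse approximation of a window function by test functions in the topology of the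
Markov window form).  For a window function `u` on `[-b, b]` and a normed bump `φ` (Mathlib `ContDiffBump`,
`φ.normed`), the mollification `φ ⋆ u = ∫ φ(t) u(· − t) dt`:

* is a Weil TEST function (`isWeilTest_mollify`: smooth by `HasCompactSupport.contDiff_convolution_left`, compact
  support) supported in `[-b − r, b + r]`, `r = φ.rOut` (`mollify_eq_zero`, `tsupport_mollify_subset`), with the same
  sup bound (`norm_mollify_le`);
* converges to `u` almost everywhere along bumps with `rOut → 0`, `rOut ≤ 2 rIn` (Lebesgue differentiation,
  Mathlib's `ContDiffBump.ae_convolution_tendsto_right_of_locallyIntegrable`), hence — dominated convergence — every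
  shift pairing converges: `∫ (φ_i⋆u)(y + x) conj (φ_i⋆u)(y) dy → ∫ u(y + x) conj u(y) dy`
  (`tendsto_integral_shift_mul_conj_mollify`; `x = 0`: the `L²` norms);
* **JENSEN CONTRACTION** (`weilIncrement_mollify_le`): `D_s(φ ⋆ u) ≤ D_s(u)` for EVERY `s` — the increments of a
  probability average are at most the increments (`|∫ φ h|² ≤ ∫ φ |h|²`, `norm_sq_integral_smul_le`, then Fubini
  `integral_convolution`); so the archimedean energy `∫₀^∞ ρ_a(s) D_s ds` never increases under smoothing and no
  uniform-in-`ε` majorant near `s = 0` is needed.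

The sequel `KeySectionToTest.lean` assembles: `limsup keyMarkovForm(φ_i ⋆ u) ≤ keyMarkovForm(u)`, hence every
section-level STRICT upper bound transfers to a genuine test function on any larger window.  Everything is proved;
no definitions; no named facts; RH/GRH-free.  Sources: standard real analysis (mollifiers; Jensen; Lebesgue
differentiation) [folklore]; the form: Bombieri 2000 Thm 2 p. 193 [Bombieri2000Weil]; Yoshida 1992 §2 [Yoshida1992].
-/

set_option autoImplicit false

noncomputable section

open Complex Filter Set MeasureTheory ContinuousLinearMap Metric
open scoped Real Topology ComplexConjugate Convolution

namespace Summit.Ventures.WeilGRH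

open Literature.NumberTheory.LFunctions
open Summit.RiemannHypothesis.RiemannHypothesis.Theorems.WeilFormatC

variable {b : ℝ} {u : ℝ → ℂ}

/-! ## Window functions: integrability and compact support -/

/-- A window function is integrable. [folklore] -/
theorem integrable_of_isWindowFunction (hu : IsWindowFunction b u) : Integrable u := by
  have h := hu.integrable_mul_continuous (w := fun _ ↦ (1 : ℂ)) continuous_const
  simpa using h

/-- A window function has compact support. [folklore] -/
theorem hasCompactSupport_of_isWindowFunction (hu : IsWindowFunction b u) : HasCompactSupport u :=
  HasCompactSupport.intro isCompact_Icc hu.eq_zero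

/-- The pointwise formula `(φ ⋆ u)(x) = ∫ φ(t) u(x − t) dt`. [folklore] -/
theorem mollify_apply (φ : ContDiffBump (0 : ℝ)) (u : ℝ → ℂ) (x : ℝ) :
    (φ.normed volume ⋆[lsmul ℝ ℝ, volume] u) x = ∫ t, ((φ.normed volume t : ℝ) : ℂ) * u (x - t) := by
  rw [convolution_lsmul]
  simp only [Complex.real_smul]

/-- The mollification integrand is integrable (bounded measurable `u`, integrable bump). [folklore] -/
theorem integrable_mollify_integrand (φ : ContDiffBump (0 : ℝ)) (hu : IsWindowFunction b u) (x : ℝ) :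
    Integrable fun t ↦ ((φ.normed volume t : ℝ) : ℂ) * u (x - t) := by
  obtain ⟨S, hS⟩ := hu.bounded
  have h1 : Integrable fun t ↦ ((φ.normed volume t : ℝ) : ℂ) := φ.integrable_normed.ofReal
  exact h1.mul_bdd (c := S) ((hu.measurable.comp (measurable_const.sub measurable_id)).aestronglyMeasurable)
    (Eventually.of_forall fun t ↦ hS _)

/-! ## Mollified window functions are test functions on a slightly larger window -/

/-- **`φ ⋆ u` is a Weil test function** (smooth with compact support). [folklore] -/
theorem isWeilTest_mollify (φ : ContDiffBump (0 : ℝ)) (hu : IsWindowFunction b u) :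
    IsWeilTest (φ.normed volume ⋆[lsmul ℝ ℝ, volume] u) :=
  ⟨φ.hasCompactSupport_normed.contDiff_convolution_left _ φ.contDiff_normed
      (integrable_of_isWindowFunction hu).locallyIntegrable,
    φ.hasCompactSupport_normed.convolution _ (hasCompactSupport_of_isWindowFunction hu)⟩

/-- `φ ⋆ u` vanishes off `[-b − r, b + r]`, `r = φ.rOut`. [folklore] -/
theorem mollify_eq_zero (φ : ContDiffBump (0 : ℝ)) (hu : IsWindowFunction b u) {x : ℝ}
    (hx : x ∉ Icc (-b - φ.rOut) (b + φ.rOut)) : (φ.normed volume ⋆[lsmul ℝ ℝ, volume] u) x = 0 := by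
  rw [mollify_apply]
  refine integral_eq_zero_of_ae (Eventually.of_forall fun t ↦ ?_)
  simp only [Pi.zero_apply]
  by_cases ht : t ∈ ball (0 : ℝ) φ.rOut
  · have hxt : x - t ∉ Icc (-b) b := by
      intro h
      apply hx
      rw [mem_ball, dist_zero_right, Real.norm_eq_abs, abs_lt] at ht
      rw [mem_Icc] at h ⊢
      constructor <;> linarith [h.1, h.2]
    rw [hu.eq_zero _ hxt, mul_zero]
  · have h0 : φ.normed volume t = 0 := by
      rw [← Function.notMem_support, φ.support_normed_eq]
      exact ht
    rw [h0, Complex.ofReal_zero, zero_mul]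

/-- The topological support of `φ ⋆ u` lies in `[-b − r, b + r]`. [folklore] -/
theorem tsupport_mollify_subset (φ : ContDiffBump (0 : ℝ)) (hu : IsWindowFunction b u) :
    tsupport (φ.normed volume ⋆[lsmul ℝ ℝ, volume] u) ⊆ Icc (-b - φ.rOut) (b + φ.rOut) :=
  closure_minimal (fun x hx ↦ by
    by_contra h
    exact hx (mollify_eq_zero φ hu h)) isClosed_Icc

/-- **Sup bound**: `‖(φ ⋆ u)(x)‖ ≤ S` if `‖u‖ ≤ S` (a probability average). [folklore] -/
theorem norm_mollify_le (φ : ContDiffBump (0 : ℝ)) (hu : IsWindowFunction b u) {S : ℝ} (hS : ∀ x, ‖u x‖ ≤ S)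
    (x : ℝ) : ‖(φ.normed volume ⋆[lsmul ℝ ℝ, volume] u) x‖ ≤ S := by
  rw [mollify_apply]
  have hint := integrable_mollify_integrand φ hu x
  calc ‖∫ t, ((φ.normed volume t : ℝ) : ℂ) * u (x - t)‖
      ≤ ∫ t, ‖((φ.normed volume t : ℝ) : ℂ) * u (x - t)‖ := norm_integral_le_integral_norm _
    _ ≤ ∫ t, φ.normed volume t * S := by
        refine integral_mono hint.norm (φ.integrable_normed.mul_const S) fun t ↦ ?_
        beta_reduce
        rw [norm_mul, Complex.norm_real, Real.norm_of_nonneg (φ.nonneg_normed _)]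
        exact mul_le_mul_of_nonneg_left (hS _) (φ.nonneg_normed _)
    _ = S := by rw [integral_mul_const, φ.integral_normed, one_mul]

/-! ## Almost-everywhere convergence and the shift pairings -/

/-- **Mollified window functions converge almost everywhere** along bumps with `rOut → 0`, `rOut ≤ 2 rIn`
(Lebesgue differentiation). [folklore] -/
theorem ae_tendsto_mollify {φ : ℕ → ContDiffBump (0 : ℝ)} (hu : IsWindowFunction b u)
    (hφ : Tendsto (fun i ↦ (φ i).rOut) atTop (𝓝 0)) (h'φ : ∀ᶠ i in atTop, (φ i).rOut ≤ 2 * (φ i).rIn) :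
    ∀ᵐ x, Tendsto (fun i ↦ ((φ i).normed volume ⋆[lsmul ℝ ℝ, volume] u) x) atTop (𝓝 (u x)) :=
  ContDiffBump.ae_convolution_tendsto_right_of_locallyIntegrable hφ h'φ
    (integrable_of_isWindowFunction hu).locallyIntegrable

/-- **The shift pairings converge**: `∫ (φ_i⋆u)(y + x) conj (φ_i⋆u)(y) dy → ∫ u(y + x) conj u(y) dy` along bumps with
`rOut → 0`, `rOut ≤ 2 rIn`, `rOut ≤ 1` (dominated convergence: a.e. convergence, common bound `S²` on
`[-b − 1, b + 1]`). [folklore] -/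
theorem tendsto_integral_shift_mul_conj_mollify {φ : ℕ → ContDiffBump (0 : ℝ)} (hu : IsWindowFunction b u)
    (hφ : Tendsto (fun i ↦ (φ i).rOut) atTop (𝓝 0)) (h'φ : ∀ᶠ i in atTop, (φ i).rOut ≤ 2 * (φ i).rIn)
    (h1 : ∀ i, (φ i).rOut ≤ 1) (x : ℝ) :
    Tendsto (fun i ↦ ∫ y, ((φ i).normed volume ⋆[lsmul ℝ ℝ, volume] u) (y + x) *
        conj (((φ i).normed volume ⋆[lsmul ℝ ℝ, volume] u) y)) atTop
      (𝓝 (∫ y, u (y + x) * conj (u y))) := by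
  obtain ⟨S, hS0, hS⟩ := hu.bounded'
  set g : ℕ → ℝ → ℂ := fun i ↦ (φ i).normed volume ⋆[lsmul ℝ ℝ, volume] u with hg
  have hcont : ∀ i, Continuous (g i) := fun i ↦ (isWeilTest_mollify (φ i) hu).1.continuous
  refine tendsto_integral_of_dominated_convergence (fun y ↦ (Icc (-b - 1) (b + 1)).indicator (fun _ ↦ S * S) y)
    (fun i ↦ (((hcont i).comp (continuous_id.add continuous_const)).mul
      (Complex.continuous_conj.comp (hcont i))).aestronglyMeasurable) ?_ ?_ ?_
  · exact (integrable_indicator_iff measurableSet_Icc).2 (integrableOn_const (by simp [Real.volume_Icc]))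
  · intro i
    refine Eventually.of_forall fun y ↦ ?_
    by_cases hy : y ∈ Icc (-b - 1) (b + 1)
    · rw [indicator_of_mem hy, norm_mul, Complex.norm_conj]
      exact mul_le_mul (norm_mollify_le (φ i) hu hS _) (norm_mollify_le (φ i) hu hS _) (norm_nonneg _) hS0
    · have hy' : y ∉ Icc (-b - (φ i).rOut) (b + (φ i).rOut) := by
        intro h
        apply hy
        rw [mem_Icc] at h ⊢
        constructor <;> linarith [h.1, h.2, h1 i]
      have h0 : ((φ i).normed volume ⋆[lsmul ℝ ℝ, volume] u) y = 0 := mollify_eq_zero (φ i) hu hy'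
      rw [h0, map_zero, mul_zero, norm_zero, indicator_of_notMem hy]
  · have hae := ae_tendsto_mollify hu hφ h'φ
    have hae' : ∀ᵐ y : ℝ, Tendsto (fun i ↦ g i (y + x)) atTop (𝓝 (u (y + x))) :=
      (measurePreserving_add_right volume x).quasiMeasurePreserving.ae hae
    filter_upwards [hae, hae'] with y hy hyx
    exact hyx.mul ((Complex.continuous_conj.tendsto _).comp hy)

/-- In particular the `L²` norms converge: `∫ ‖φ_i⋆u‖² → ∫ ‖u‖²`. [folklore] -/
theorem tendsto_integral_norm_sq_mollify {φ : ℕ → ContDiffBump (0 : ℝ)} (hu : IsWindowFunction b u)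
    (hφ : Tendsto (fun i ↦ (φ i).rOut) atTop (𝓝 0)) (h'φ : ∀ᶠ i in atTop, (φ i).rOut ≤ 2 * (φ i).rIn)
    (h1 : ∀ i, (φ i).rOut ≤ 1) :
    Tendsto (fun i ↦ ∫ y, ‖((φ i).normed volume ⋆[lsmul ℝ ℝ, volume] u) y‖ ^ 2) atTop
      (𝓝 (∫ y, ‖u y‖ ^ 2)) := by
  have h := tendsto_integral_shift_mul_conj_mollify hu hφ h'φ h1 0
  simp only [add_zero] at h
  have e : ∀ w : ℝ → ℂ, ∫ y, w y * conj (w y) = ((∫ y, ‖w y‖ ^ 2 : ℝ) : ℂ) := by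
    intro w
    rw [← integral_complex_ofReal]
    exact integral_congr_ae (Eventually.of_forall fun y ↦ by
      beta_reduce; rw [Complex.mul_conj, Complex.normSq_eq_norm_sq])
  simp_rw [e] at h
  exact_mod_cast (Complex.continuous_re.tendsto _).comp h

/-! ## Jensen contraction: the increments do not grow under smoothing -/

/-- **Jensen for a probability density**: `φ ≥ 0`, `∫ φ = 1`, `h` bounded measurable ⇒
`‖∫ φ(t) h(t) dt‖² ≤ ∫ φ(t) ‖h(t)‖² dt` (the variance `∫ φ ‖h − c‖² ≥ 0`, `c = ∫ φ h`). [folklore] -/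
theorem norm_sq_integral_smul_le {φ : ℝ → ℝ} (hφ0 : ∀ t, 0 ≤ φ t) (hφ1 : ∫ t, φ t = 1)
    (hφi : Integrable φ) {h : ℝ → ℂ} (hh : AEStronglyMeasurable h) {S : ℝ} (hb : ∀ t, ‖h t‖ ≤ S) :
    ‖∫ t, (φ t : ℂ) * h t‖ ^ 2 ≤ ∫ t, φ t * ‖h t‖ ^ 2 := by
  set c : ℂ := ∫ t, (φ t : ℂ) * h t with hc
  have hI1 : Integrable fun t ↦ (φ t : ℂ) * h t :=
    hφi.ofReal.mul_bdd (c := S) hh (Eventually.of_forall hb)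
  have hI2 : Integrable fun t ↦ φ t * ‖h t‖ ^ 2 := by
    refine hφi.mul_bdd (c := S ^ 2) (hh.norm.pow 2) (Eventually.of_forall fun t ↦ ?_)
    rw [Real.norm_of_nonneg (by positivity)]
    exact pow_le_pow_left₀ (norm_nonneg _) (hb t) 2
  have hI3 : Integrable fun t ↦ φ t * (h t * conj c).re := by
    have := (hI1.mul_const (conj c)).re
    refine this.congr (Eventually.of_forall fun t ↦ ?_)
    simp only [RCLike.re_to_complex, mul_assoc, Complex.re_ofReal_mul]
  -- the variance is non-negative
  have hvar : 0 ≤ ∫ t, φ t * ‖h t - c‖ ^ 2 := integral_nonneg fun t ↦ mul_nonneg (hφ0 t) (by positivity)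
  -- expand the variance
  have e : ∀ t, φ t * ‖h t - c‖ ^ 2 = φ t * ‖h t‖ ^ 2 - 2 * (φ t * (h t * conj c).re) + ‖c‖ ^ 2 * φ t := by
    intro t
    rw [← Complex.normSq_eq_norm_sq, Complex.normSq_sub, Complex.normSq_eq_norm_sq, Complex.normSq_eq_norm_sq]
    ring
  have hre : ∫ t, φ t * (h t * conj c).re = ‖c‖ ^ 2 := by
    have h1 : ∫ t, φ t * (h t * conj c).re = (∫ t, (φ t : ℂ) * h t * conj c).re := by
      have h2 := integral_re (hI1.mul_const (conj c))
      simp only [RCLike.re_to_complex] at h2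
      rw [← h2]
      refine integral_congr_ae (Eventually.of_forall fun t ↦ ?_)
      simp only [mul_assoc, Complex.re_ofReal_mul]
    rw [h1, integral_mul_const, ← hc, Complex.mul_conj, Complex.normSq_eq_norm_sq]
    norm_cast
  simp_rw [e] at hvar
  have hA : Integrable fun t ↦ φ t * ‖h t‖ ^ 2 - 2 * (φ t * (h t * conj c).re) := hI2.sub (hI3.const_mul 2)
  have hB : Integrable fun t ↦ ‖c‖ ^ 2 * φ t := hφi.const_mul _
  rw [integral_add hA hB, integral_sub hI2 (hI3.const_mul 2), integral_const_mul, integral_const_mul, hre,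
    hφ1] at hvar
  linarith

/-- The increment of the mollification is the mollification of the increment:
`(φ⋆u)(x + s) − (φ⋆u)(x) = ∫ φ(t) (u(x − t + s) − u(x − t)) dt`. [folklore] -/
theorem mollify_shift_sub (φ : ContDiffBump (0 : ℝ)) (hu : IsWindowFunction b u) (s x : ℝ) :
    (φ.normed volume ⋆[lsmul ℝ ℝ, volume] u) (x + s) - (φ.normed volume ⋆[lsmul ℝ ℝ, volume] u) x =
      ∫ t, ((φ.normed volume t : ℝ) : ℂ) * (u (x - t + s) - u (x - t)) := by
  rw [mollify_apply, mollify_apply, ← integral_sub (integrable_mollify_integrand φ hu (x + s))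
    (integrable_mollify_integrand φ hu x)]
  refine integral_congr_ae (Eventually.of_forall fun t ↦ ?_)
  beta_reduce
  rw [mul_sub, show x + s - t = x - t + s by ring]

/-- `‖u(· + s) − u‖²` is integrable for a window function; its integral is `D_s(u)`. [folklore] -/
theorem integrable_norm_sq_shift_sub (hu : IsWindowFunction b u) (s : ℝ) :
    Integrable fun y ↦ ‖u (y + s) - u y‖ ^ 2 := by
  obtain ⟨hm, hz, S, hS0, hS⟩ := hu.shift_sub s
  have hint : Integrable fun y ↦ (Icc (-b - |s|) (b + |s|)).indicator (fun _ ↦ S ^ 2) y :=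
    (integrable_indicator_iff measurableSet_Icc).2 (integrableOn_const (by simp [Real.volume_Icc]))
  refine hint.mono' (hm.norm.pow_const 2).aestronglyMeasurable (Eventually.of_forall fun y ↦ ?_)
  rw [Real.norm_of_nonneg (by positivity : (0 : ℝ) ≤ ‖u (y + s) - u y‖ ^ 2)]
  by_cases hy : y ∈ Icc (-b - |s|) (b + |s|)
  · rw [indicator_of_mem hy]
    exact pow_le_pow_left₀ (norm_nonneg _) (hS y) 2
  · rw [hz y hy, norm_zero, indicator_of_notMem hy]
    norm_num

/-- **JENSEN CONTRACTION OF THE INCREMENTS**: `D_s(φ ⋆ u) ≤ D_s(u)` for every window function `u`, bump `φ`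
and shift `s` — pointwise Jensen `‖∫φ(t)w(x−t)dt‖² ≤ ∫φ(t)‖w(x−t)‖²dt` for `w = u(·+s) − u`, then Fubini
(`integral_convolution`: `∫ (φ ⋆ ‖w‖²) = (∫φ)·∫‖w‖² = D_s(u)`). [folklore] -/
theorem weilIncrement_mollify_le (φ : ContDiffBump (0 : ℝ)) (hu : IsWindowFunction b u) (s : ℝ) :
    weilIncrement (φ.normed volume ⋆[lsmul ℝ ℝ, volume] u) s ≤ weilIncrement u s := by
  obtain ⟨hm, hz, S, hS0, hS⟩ := hu.shift_sub s
  set w : ℝ → ℂ := fun y ↦ u (y + s) - u y with hw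
  have hwi : Integrable fun y ↦ ‖w y‖ ^ 2 := integrable_norm_sq_shift_sub hu s
  -- pointwise Jensen
  have hpt : ∀ x, ‖(φ.normed volume ⋆[lsmul ℝ ℝ, volume] u) (x + s) -
      (φ.normed volume ⋆[lsmul ℝ ℝ, volume] u) x‖ ^ 2 ≤
      (φ.normed volume ⋆[lsmul ℝ ℝ, volume] fun y ↦ ‖w y‖ ^ 2) x := by
    intro x
    rw [mollify_shift_sub φ hu s x, convolution_lsmul]
    simp only [smul_eq_mul]
    have hJ := norm_sq_integral_smul_le (φ.nonneg_normed (μ := volume)) φ.integral_normed φ.integrable_normed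
      (h := fun t ↦ w (x - t)) ((hm.comp (measurable_const.sub measurable_id)).aestronglyMeasurable)
      (fun t ↦ hS (x - t))
    simpa only [hw] using hJ
  -- integrate: the right side integrates to D_s(u)
  have hR : ∫ x, (φ.normed volume ⋆[lsmul ℝ ℝ, volume] fun y ↦ ‖w y‖ ^ 2) x = weilIncrement u s := by
    rw [integral_convolution (lsmul ℝ ℝ) φ.integrable_normed hwi, lsmul_apply, φ.integral_normed, one_smul]
    rfl
  calc weilIncrement (φ.normed volume ⋆[lsmul ℝ ℝ, volume] u) s
      = ∫ x, ‖(φ.normed volume ⋆[lsmul ℝ ℝ, volume] u) (x + s) -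
          (φ.normed volume ⋆[lsmul ℝ ℝ, volume] u) x‖ ^ 2 := rfl
    _ ≤ ∫ x, (φ.normed volume ⋆[lsmul ℝ ℝ, volume] fun y ↦ ‖w y‖ ^ 2) x :=
        integral_mono_of_nonneg (Eventually.of_forall fun x ↦ by positivity)
          (φ.integrable_normed.integrable_convolution _ hwi) (Eventually.of_forall hpt)
    _ = weilIncrement u s := hR

end Summit.Ventures.WeilGRH

end
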